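import Literature.NumberTheory.Sieve.FriedlanderIwaniecPrimesLemma31Weighted
import Literature.NumberTheory.Sieve.FriedlanderIwaniecPrimesRough
import HarnessLib

/-!
# Friedlander–Iwaniec, *The polynomial `X² + Y⁴` captures its primes*: Lemma 3.1 PROVED

Family `parity`, statement parity.S17. Source: J. Friedlander, H. Iwaniec, Ann. of Math. (2) 148
(1998), 945–1040 [FriedlanderIwaniecAnnals1998], §3, Lemma 3.1 (3.3) (arXiv p. 10):
"LEMMA 3.1. For any `D ≥ 1`, any `ε > 0`, and any `x ≥ 2`,
`∑_{d ≤ D} |A_d(x) - M_d(x)| ≪ D^{1/4} x^{9/16+ε}`, where `M_d(x) = g(d) 4κ x^{3/4}`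
[the tree's `fiMainTerm`], the implied constant depending only on `ε`."
and its proof (pp. 11–13): "On summing the above three estimates [(3.10), (3.12), (3.13)] we
obtain `∑_{d ≤ D} |A_d(x) - M_d(x)| ≪ (y x^{-1/4} + D^{1/2} x^{11/8} y^{-1}) x^ε`, which yields
(3.3) on choosing `y = D^{1/4} x^{13/16}`. Observe that (3.3) is trivial if `y > x/2`."

This file assembles the tree's named fact `FriedlanderIwaniec1998_lemma31` (stated in
`FriedlanderIwaniecPrimesMainTerm`) from the PROVED pieces:
`abs_congrSum_sub_fiMainTerm_le`, `sum_fiAzero_le`, `sum_fiMzero_le`, `sum_sum_fiStripSlice_le`,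
`norm_fiPoissonErr_le` (`…Lemma31Smoothing`), `strip_count_le`, `sum_card_fiRoots_div_le`
(`…Lemma31Counting`), `sum_abs_fiE_le` (`…Lemma31Weighted`, which rests on the proved Lemma 3.3
`fi_lemma33`), the divisor bound `exists_card_divisors_le_mul_rpow`, and the trivial bound
`∑_{d ≤ D} (A_d + M_d) ≪ τ-bounds · x^{3/4} (log)^2` in the complementary regime.

* `FriedlanderIwaniec1998_lemma31_holds : FriedlanderIwaniec1998_lemma31` — **Lemma 3.1 PROVED**;
* `FriedlanderIwaniec1998_prop35_holds : FriedlanderIwaniec1998_prop35` (Proposition 3.5, via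
  `FriedlanderIwaniec1998_prop35_of_lemma31`);
* `friedlanderIwaniecSum_isEquivalent_of_rough_prop41` — parity.S17 from the two remaining inputs
  `fi_asymptotic_sieve_primes_rough_loglog` (the asymptotic sieve for primes, companion paper) and
  `FriedlanderIwaniec1998_prop41` (the bilinear estimate, §§4–26).

## References

* J. Friedlander, H. Iwaniec, Ann. of Math. (2) 148 (1998), 945–1040, §3, Lemma 3.1.
  [cite: FriedlanderIwaniecAnnals1998, §3 Lemma 3.1 (3.3)]

## Mathlib / tree search

Tree: everything listed above; `congrSum_eq_card`, `fiCount`, `abs_fiCount_sub_le`,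
`friedlanderIwaniecKappa_le_one`, `fiDisc_eq_insert_fiPoints`. Mathlib: `Real.log_le_rpow_div`
(`log u ≤ u^δ/δ`), `Real.rpow_le_rpow_of_exponent_le`.
-/

noncomputable section

open Finset Real MeasureTheory Filter Complex
open scoped FourierTransform

namespace Literature.NumberTheory.Sieve.FriedlanderIwaniecPrimes

/-! ### Elementary real inequalities -/

/-- `1 + log u ≤ (1 + 1/δ) u^δ` for `u ≥ 1`, `δ > 0`. [folklore] -/
theorem one_add_log_le_rpow {u δ : ℝ} (hu : 1 ≤ u) (hδ : 0 < δ) :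
    1 + Real.log u ≤ (1 + 1 / δ) * u ^ δ := by
  have hu0 : 0 ≤ u := zero_le_one.trans hu
  have h1 : Real.log u ≤ u ^ δ / δ := Real.log_le_rpow_div hu0 hδ
  have h2 : (1 : ℝ) ≤ u ^ δ := Real.one_le_rpow hu hδ.le
  calc 1 + Real.log u ≤ u ^ δ + u ^ δ / δ := add_le_add h2 h1
    _ = (1 + 1 / δ) * u ^ δ := by ring

/-- `(1 + log u)² ≤ (1 + 1/δ)² u^{2δ}` for `u ≥ 1`, `δ > 0`. [folklore] -/
theorem one_add_log_sq_le_rpow {u δ : ℝ} (hu : 1 ≤ u) (hδ : 0 < δ) :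
    (1 + Real.log u) ^ 2 ≤ (1 + 1 / δ) ^ 2 * u ^ (2 * δ) := by
  have hu0 : 0 < u := by linarith
  have h0 : 0 ≤ 1 + Real.log u := by have := Real.log_nonneg hu; linarith
  calc (1 + Real.log u) ^ 2 ≤ ((1 + 1 / δ) * u ^ δ) ^ 2 :=
        pow_le_pow_left₀ h0 (one_add_log_le_rpow hu hδ) 2
    _ = (1 + 1 / δ) ^ 2 * u ^ (2 * δ) := by
        rw [mul_pow, ← Real.rpow_natCast (u ^ δ), ← Real.rpow_mul hu0.le]
        norm_num; left; ring_nf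

/-- `(1 + log D)² ≤ (1 + 1/δ)² D^{2δ}` for a natural number `D` (`D = 0` included). [folklore] -/
theorem one_add_log_nat_sq_le {δ : ℝ} (hδ : 0 < δ) (D : ℕ) (hD : 1 ≤ D) :
    (1 + Real.log D) ^ 2 ≤ (1 + 1 / δ) ^ 2 * (D : ℝ) ^ (2 * δ) :=
  one_add_log_sq_le_rpow (by exact_mod_cast hD) hδ

/-! ### The trivial bound `∑_{d ≤ D} (A_d(x) + M_d(x))` -/

/-- `#fiPoints ⌊x⌋ = A(x)`. [folklore] -/
theorem card_fiPoints_eq (x : ℝ) : (#(fiPoints ⌊x⌋₊) : ℝ) = fiCount x := by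
  have h := sum_fiRepCount_add_one ⌊x⌋₊
  rw [fiDisc_eq_insert_fiPoints, card_insert_of_notMem (origin_not_mem_fiPoints _)] at h
  rw [fiCount]
  have := congrArg (fun n : ℕ => (n : ℝ)) h
  push_cast at this
  linarith

/-- `A(x) ≤ 18 x^{3/4}` for `x ≥ 1`. [folklore] -/
theorem fiCount_le {x : ℝ} (hx : 1 ≤ x) : fiCount x ≤ 18 * x ^ (3 / 4 : ℝ) := by
  have h := abs_fiCount_sub_le hx
  rw [abs_le] at h
  have hκ := friedlanderIwaniecKappa_le_one
  have hκ0 := friedlanderIwaniecKappa_pos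
  have hx0 : 0 < x := by linarith
  have h34 : 0 ≤ x ^ (3 / 4 : ℝ) := by positivity
  have hsqrt : Real.sqrt x ≤ x ^ (3 / 4 : ℝ) := by
    rw [Real.sqrt_eq_rpow]
    exact Real.rpow_le_rpow_of_exponent_le hx (by norm_num)
  nlinarith

/-- **`∑_{d ≤ D} A_d(x) ≤ T · A(x)`** (`τ(n) ≤ T` for `1 ≤ n ≤ ⌊x⌋`): each point is counted once for
every divisor `d ≤ D` of `a² + c⁴`. [folklore] -/
theorem sum_congrSum_le {x : ℝ} {T : ℕ} (hT : ∀ n : ℕ, n ≠ 0 → n ≤ ⌊x⌋₊ → #n.divisors ≤ T)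
    (D : ℕ) : ∑ d ∈ Icc 1 D, fiSieveSeq.congrSum d x ≤ T * fiCount x := by
  set N := ⌊x⌋₊ with hN
  simp_rw [congrSum_eq_card]
  rw [← hN, ← card_fiPoints_eq, ← hN]
  calc ∑ d ∈ Icc 1 D, (#{P ∈ fiPoints N | d ∣ fiQuartic P} : ℝ)
      = ∑ P ∈ fiPoints N, (#{d ∈ Icc 1 D | d ∣ fiQuartic P} : ℝ) := by
        simp only [card_filter, Nat.cast_sum, Nat.cast_ite, Nat.cast_one, Nat.cast_zero]
        exact sum_comm
    _ ≤ ∑ P ∈ fiPoints N, (T : ℝ) := by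
        refine sum_le_sum fun P hP => ?_
        rw [fiPoints, mem_filter, mem_Icc] at hP
        have hq0 : fiQuartic P ≠ 0 := by omega
        calc (#{d ∈ Icc 1 D | d ∣ fiQuartic P} : ℝ) ≤ #(fiQuartic P).divisors := by
              exact_mod_cast card_le_card fun d hd => Nat.mem_divisors.mpr
                ⟨(mem_filter.mp hd).2, hq0⟩
          _ ≤ T := by exact_mod_cast hT _ hq0 hP.2.2
    _ = T * #(fiPoints N) := by rw [sum_const, nsmul_eq_mul, mul_comm]

/-- The divisor count of `ℓ_c² = c⁴ ≤ ⌊x⌋` is at most `T`. [folklore] -/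
theorem card_divisors_natAbs_le {x : ℝ} {T : ℕ} (hT : ∀ n : ℕ, n ≠ 0 → n ≤ ⌊x⌋₊ → #n.divisors ≤ T)
    {c : ℤ} (hc : c ∈ fiCRange ⌊x⌋₊) : #((c.natAbs ^ 2) ^ 2).divisors ≤ T := by
  rw [mem_fiCRange] at hc
  have h4 : (c.natAbs ^ 2) ^ 2 = c.natAbs ^ 4 := by ring
  rw [h4]
  refine hT _ (pow_ne_zero 4 (Int.natAbs_ne_zero.mpr hc.1)) ?_
  have : ((c.natAbs ^ 4 : ℕ) : ℤ) ≤ ⌊x⌋₊ := by rw [← pow_four_eq_natAbs]; exact hc.2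
  exact_mod_cast this

/-- **The `ρ`-weighted sums over `d`**: for weights `w_c ≥ 0` on `fiCRange`,
`∑_{d ≤ D} d⁻¹ ∑_c ρ(c²; d) w_c ≤ C_H T (1 + log D)² ∑_c w_c`.
[cite: FriedlanderIwaniecAnnals1998, §3, "∑_{d ≤ D} d⁻¹ ρ(c²; d) ≪ (log 2D)²"] -/
theorem sum_div_sum_rho_mul_le {x : ℝ} {T : ℕ} (hT : ∀ n : ℕ, n ≠ 0 → n ≤ ⌊x⌋₊ → #n.divisors ≤ T)
    {C : ℕ} (hC : ∀ n, n ≠ 0 → fiRho n ≤ C * #n.divisors) {w : ℤ → ℝ}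
    (hw : ∀ c ∈ fiCRange ⌊x⌋₊, 0 ≤ w c) (D : ℕ) :
    ∑ d ∈ Icc 1 D, (∑ c ∈ fiCRange ⌊x⌋₊, (#(fiRoots (c.natAbs ^ 2) d) : ℝ) * w c) / d ≤
      C * T * (1 + Real.log D) ^ 2 * ∑ c ∈ fiCRange ⌊x⌋₊, w c := by
  have hlog := one_add_log_nonneg D
  calc ∑ d ∈ Icc 1 D, (∑ c ∈ fiCRange ⌊x⌋₊, (#(fiRoots (c.natAbs ^ 2) d) : ℝ) * w c) / d
      = ∑ c ∈ fiCRange ⌊x⌋₊, w c * ∑ d ∈ Icc 1 D, (#(fiRoots (c.natAbs ^ 2) d) : ℝ) / d := by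
        simp_rw [sum_div, mul_sum]
        rw [sum_comm]
        refine sum_congr rfl fun c _ => sum_congr rfl fun d _ => ?_
        ring
    _ ≤ ∑ c ∈ fiCRange ⌊x⌋₊, w c * (C * T * (1 + Real.log D) ^ 2) := by
        refine sum_le_sum fun c hc => mul_le_mul_of_nonneg_left ?_ (hw c hc)
        have hℓ : 0 < c.natAbs ^ 2 := pow_pos (Int.natAbs_pos.mpr (mem_fiCRange.mp hc).1) 2
        refine (sum_card_fiRoots_div_le hC hℓ D).trans ?_
        have hτ : (#((c.natAbs ^ 2) ^ 2).divisors : ℝ) ≤ T := by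
          exact_mod_cast card_divisors_natAbs_le hT hc
        have : (C : ℝ) * #((c.natAbs ^ 2) ^ 2).divisors ≤ C * T :=
          mul_le_mul_of_nonneg_left hτ (Nat.cast_nonneg _)
        nlinarith [sq_nonneg (1 + Real.log D)]
    _ = C * T * (1 + Real.log D) ^ 2 * ∑ c ∈ fiCRange ⌊x⌋₊, w c := by rw [← sum_mul]; ring

/-- `∑_{c ∈ fiCRange} #{a : a² + c⁴ ≤ N} ≤ #fiDisc N = A(x) + 1`. [folklore] -/
theorem sum_fiSliceCount_le (x : ℝ) :
    ∑ c ∈ fiCRange ⌊x⌋₊, (fiSliceCount ⌊x⌋₊ c : ℝ) ≤ fiCount x + 1 := by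
  set N := ⌊x⌋₊ with hN
  have hcard : ∑ c ∈ Icc (-(N : ℤ)) N, (fiSliceCount N c : ℝ) = #(fiDisc N) := by
    rw [fiDisc, fiBox, card_eq_sum_ones, sum_filter, sum_product_right]
    push_cast
    refine sum_congr rfl fun c _ => ?_
    rw [fiSliceCount, card_eq_sum_ones, sum_filter]
    push_cast
    rfl
  have hsub : fiCRange N ⊆ Icc (-(N : ℤ)) N := by
    intro c hc
    rw [← filter_Icc_eq_fiCRange] at hc
    exact (mem_filter.mp hc).1
  calc ∑ c ∈ fiCRange N, (fiSliceCount N c : ℝ) ≤ ∑ c ∈ Icc (-(N : ℤ)) N, (fiSliceCount N c : ℝ) :=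
        sum_le_sum_of_subset_of_nonneg hsub fun _ _ _ => Nat.cast_nonneg _
    _ = #(fiDisc N) := hcard
    _ = fiCount x + 1 := by
        have h := sum_fiRepCount_add_one N
        rw [fiCount, ← hN]
        have := congrArg (fun n : ℕ => (n : ℝ)) h
        push_cast at this
        linarith

/-- **The trivial bound**: `∑_{d ≤ D} |A_d(x) - M_d(x)| ≤ 40 C_H T x^{3/4} (1 + log D)²` for `x ≥ 1`
("Observe that (3.3) is trivial if y > x/2"). [cite: FriedlanderIwaniecAnnals1998, §3, proof of Lemma 3.1] -/
theorem sum_abs_sub_le_trivial {x : ℝ} (hx : 1 ≤ x) {T : ℕ}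
    (hT : ∀ n : ℕ, n ≠ 0 → n ≤ ⌊x⌋₊ → #n.divisors ≤ T) (hT1 : 1 ≤ T) {C : ℕ} (hC1 : 1 ≤ C)
    (hC : ∀ n, n ≠ 0 → fiRho n ≤ C * #n.divisors) (D : ℕ) :
    ∑ d ∈ Icc 1 D, |fiSieveSeq.congrSum d x - fiMainTerm d x| ≤
      40 * C * T * x ^ (3 / 4 : ℝ) * (1 + Real.log D) ^ 2 := by
  have hx0 : 0 < x := by linarith
  have hA := fiCount_le hx
  have hA0 : 0 ≤ fiCount x := by rw [← card_fiPoints_eq]; exact Nat.cast_nonneg _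
  have hlog := one_add_log_nonneg D
  have hL1 : 1 ≤ (1 + Real.log D) ^ 2 ∨ D = 0 := by
    rcases Nat.eq_zero_or_pos D with rfl | hD
    · right; rfl
    · left
      have : 0 ≤ Real.log D := Real.log_nonneg (by exact_mod_cast hD)
      nlinarith
  rcases hL1 with hL1 | rfl
  swap
  · simp; positivity
  have hTr : (1 : ℝ) ≤ T := by exact_mod_cast hT1
  have hCr : (1 : ℝ) ≤ C := by exact_mod_cast hC1
  -- `|A_d - M_d| ≤ A_d + M_d`
  have hpt : ∀ d ∈ Icc 1 D, |fiSieveSeq.congrSum d x - fiMainTerm d x| ≤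
      fiSieveSeq.congrSum d x + (fiMzero x d + fiMstar x d) := by
    intro d hd
    rw [Finset.mem_Icc] at hd
    rw [fiMainTerm_eq_fiMzero_add_fiMstar (by omega)]
    have h1 : 0 ≤ fiSieveSeq.congrSum d x := by
      rw [congrSum_eq_card]; exact Nat.cast_nonneg _
    have h2 : 0 ≤ fiMzero x d := (fiMzero_mem_Icc x d).1
    have h3 : 0 ≤ fiMstar x d := by
      rw [fiMstar]; exact div_nonneg (sum_nonneg fun _ _ => by positivity) (Nat.cast_nonneg _)
    rw [abs_le]; constructor <;> linarith
  refine (sum_le_sum hpt).trans ?_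
  rw [sum_add_distrib, sum_add_distrib]
  have h1 : ∑ d ∈ Icc 1 D, fiSieveSeq.congrSum d x ≤ T * (18 * x ^ (3 / 4 : ℝ)) :=
    (sum_congrSum_le hT D).trans (mul_le_mul_of_nonneg_left hA (Nat.cast_nonneg _))
  have h2 := sum_fiMzero_le x D
  have h3 : ∑ d ∈ Icc 1 D, fiMstar x d ≤ C * T * (1 + Real.log D) ^ 2 * (19 * x ^ (3 / 4 : ℝ)) := by
    have := sum_div_sum_rho_mul_le hT hC (w := fun c => (fiSliceCount ⌊x⌋₊ c : ℝ))
      (fun _ _ => Nat.cast_nonneg _) D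
    refine le_trans (le_of_eq (sum_congr rfl fun d _ => by rw [fiMstar])) (this.trans ?_)
    refine mul_le_mul_of_nonneg_left ((sum_fiSliceCount_le x).trans ?_) (by positivity)
    have : (1 : ℝ) ≤ x ^ (3 / 4 : ℝ) := Real.one_le_rpow hx (by norm_num)
    linarith
  have hsqrt : Real.sqrt x ≤ x ^ (3 / 4 : ℝ) := by
    rw [Real.sqrt_eq_rpow]; exact Real.rpow_le_rpow_of_exponent_le hx (by norm_num)
  have h34 : 0 ≤ x ^ (3 / 4 : ℝ) := by positivity
  have hCT : (1 : ℝ) ≤ C * T := by nlinarith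
  calc ∑ d ∈ Icc 1 D, fiSieveSeq.congrSum d x +
        (∑ d ∈ Icc 1 D, fiMzero x d + ∑ d ∈ Icc 1 D, fiMstar x d)
      ≤ T * (18 * x ^ (3 / 4 : ℝ)) + (2 * Real.sqrt x * (1 + Real.log D) ^ 2 +
          C * T * (1 + Real.log D) ^ 2 * (19 * x ^ (3 / 4 : ℝ))) := add_le_add h1 (add_le_add h2 h3)
    _ ≤ C * T * (1 + Real.log D) ^ 2 * (18 * x ^ (3 / 4 : ℝ)) +
        (2 * (C * T) * x ^ (3 / 4 : ℝ) * (1 + Real.log D) ^ 2 +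
          C * T * (1 + Real.log D) ^ 2 * (19 * x ^ (3 / 4 : ℝ))) := by
        have i1 : (T : ℝ) * (18 * x ^ (3 / 4 : ℝ)) ≤ C * T * (1 + Real.log D) ^ 2 * (18 * x ^ (3 / 4 : ℝ)) := by
          calc (T : ℝ) * (18 * x ^ (3 / 4 : ℝ)) = 1 * T * 1 * (18 * x ^ (3 / 4 : ℝ)) := by ring
            _ ≤ C * T * (1 + Real.log D) ^ 2 * (18 * x ^ (3 / 4 : ℝ)) := by gcongr
        have i2 : 2 * Real.sqrt x * (1 + Real.log D) ^ 2 ≤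
            2 * (C * T) * x ^ (3 / 4 : ℝ) * (1 + Real.log D) ^ 2 := by
          calc 2 * Real.sqrt x * (1 + Real.log D) ^ 2 = 2 * 1 * Real.sqrt x * (1 + Real.log D) ^ 2 := by
                ring
            _ ≤ 2 * (C * T) * x ^ (3 / 4 : ℝ) * (1 + Real.log D) ^ 2 := by gcongr
        linarith
    _ = 39 * C * T * x ^ (3 / 4 : ℝ) * (1 + Real.log D) ^ 2 := by ring
    _ ≤ 40 * C * T * x ^ (3 / 4 : ℝ) * (1 + Real.log D) ^ 2 := by gcongr; norm_num

/-! ### The analytic regime: (3.10) + (3.12) + (3.13) summed -/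

/-- `#fiCRange N = 2 C₁` as a real sum. [folklore] -/
theorem sum_fiCRange_const (N : ℕ) (a : ℝ) :
    ∑ _c ∈ fiCRange N, a = 2 * (Nat.sqrt (Nat.sqrt N)) * a := by
  rw [fiCRange, sum_Icc_neg_filter_ne_zero (h := fun _ => a) (fun _ => rfl), sum_const, Int.card_Icc,
    nsmul_eq_mul]
  simp only [add_sub_cancel_right, Int.toNat_natCast]
  ring

/-- **The three estimates summed** ("On summing the above three estimates we obtain …"): for
`x ≥ 1`, `x^{1/2+η} ≤ y`, `2y ≤ x`, `1 ≤ x - y`, `D ≤ x`, with `τ ≤ T` on `[1, ⌊x⌋]`, `ρ ≤ C_H τ`,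
the constant `c` of Lemma 3.3 (exponent `ε₃`) and `Mₙ` bounding the derivatives of the cutoff,
`∑_{d ≤ D} |A_d(x) - M_d(x)| ≤ 2√xT + 2√x(1+log D)² + T·S + 7(128√2 c x^{11/8+η+5ε₃/2}/y + 32n!M)√D
  + C_H T (1+log D)² (T·S + 2C₁ · 4L(2π)^{-n})`, `S = 4yx^{-1/4} + 28√x`, `L = 2√x n!M(2√x/y)ⁿ`.
[cite: FriedlanderIwaniecAnnals1998, §3, proof of Lemma 3.1, (3.10)+(3.12)+(3.13)] -/
theorem sum_abs_sub_le_analytic {ε₃ c : ℝ} (hε₃ : 0 < ε₃) (hε₃1 : ε₃ ≤ 1) (hc0 : 0 < c)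
    (hc : ∀ (D K L : ℕ) (ξ : ℕ → ℕ → ℂ),
      ∑ d ∈ Finset.Icc 1 D, ‖∑ k ∈ Finset.Icc 1 K, ∑ ℓ ∈ Finset.Icc 1 L, ξ k ℓ * fiWeyl k ℓ d‖ ≤
        c * ((D : ℝ) * K * L) ^ ε₃ * ((D : ℝ) + Real.sqrt ((D : ℝ) * K * L)) *
          Real.sqrt (∑ k ∈ Finset.Icc 1 K, ∑ ℓ ∈ Finset.Icc 1 L, ‖ξ k ℓ‖ ^ 2))
    {x y η : ℝ} (hx : 1 ≤ x) (hη : 0 < η) (hxy : x ^ (1 / 2 + η) ≤ y) (hy2 : 2 * y ≤ x)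
    (hxy1 : 1 ≤ x - y) {n : ℕ} (hn : 2 ≤ n) (hηn : 4 ≤ η * n) {M : ℝ} (hM0 : 0 ≤ M)
    (hM : ∀ i ≤ n, ∀ s : ℝ, ‖iteratedFDeriv ℝ i Real.smoothTransition s‖ ≤ M)
    {T : ℕ} (hT : ∀ m : ℕ, m ≠ 0 → m ≤ ⌊x⌋₊ → #m.divisors ≤ T)
    {C : ℕ} (hC : ∀ m, m ≠ 0 → fiRho m ≤ C * #m.divisors) {D : ℕ} (hDx : (D : ℝ) ≤ x) :
    ∑ d ∈ Icc 1 D, |fiSieveSeq.congrSum d x - fiMainTerm d x| ≤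
      2 * Real.sqrt x * T + 2 * Real.sqrt x * (1 + Real.log D) ^ 2 +
        T * (4 * y * x ^ (-(1 / 4 : ℝ)) + 28 * Real.sqrt x) +
        7 * (128 * Real.sqrt 2 * c * x ^ (11 / 8 + η + 5 / 2 * ε₃) / y + 32 * n.factorial * M) *
          Real.sqrt D +
        C * T * (1 + Real.log D) ^ 2 * (T * (4 * y * x ^ (-(1 / 4 : ℝ)) + 28 * Real.sqrt x) +
          2 * (Nat.sqrt (Nat.sqrt ⌊x⌋₊)) * (4 * (2 * Real.sqrt x * (n.factorial * M *
            (2 * Real.sqrt x / y) ^ n)) * ((1 : ℝ) / (2 * π)) ^ n)) := by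
  have hx0 : 0 < x := by linarith
  have hy0 : 0 < y := (Real.rpow_pos_of_pos hx0 _).trans_le hxy
  have hyx : y ≤ x := by linarith
  set N := ⌊x⌋₊ with hN
  set St : ℝ := 4 * y * x ^ (-(1 / 4 : ℝ)) + 28 * Real.sqrt x with hSt
  set Pm : ℝ := 4 * (2 * Real.sqrt x * (n.factorial * M * (2 * Real.sqrt x / y) ^ n)) *
    ((1 : ℝ) / (2 * π)) ^ n with hPm
  have hstrip : (#((fiDisc N).filter (fun ac => (⌊x - y⌋₊ : ℤ) < ac.1 ^ 2 + ac.2 ^ 4)) : ℝ) ≤ St :=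
    strip_count_le hxy1 hy0.le hy2
  -- pointwise decomposition, summed
  have hpt : ∀ d ∈ Icc 1 D, |fiSieveSeq.congrSum d x - fiMainTerm d x| ≤
      fiAzero x d + fiMzero x d + ∑ c' ∈ fiCRange N, (fiStripSlice x y d c' : ℝ) + |fiE x y d| +
        (∑ c' ∈ fiCRange N, (#(fiRoots (c'.natAbs ^ 2) d) : ℝ) *
          (fiStripSlice x y 1 c' + ‖fiPoissonErr x y c'‖)) / d := by
    intro d hd
    rw [Finset.mem_Icc] at hd
    exact abs_congrSum_sub_fiMainTerm_le hy0 hyx (by omega)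
  refine (sum_le_sum hpt).trans ?_
  rw [sum_add_distrib, sum_add_distrib, sum_add_distrib, sum_add_distrib]
  -- the five sums
  have h1 : ∑ d ∈ Icc 1 D, (fiAzero x d : ℝ) ≤ 2 * Real.sqrt x * T := sum_fiAzero_le hT D
  have h2 : ∑ d ∈ Icc 1 D, fiMzero x d ≤ 2 * Real.sqrt x * (1 + Real.log D) ^ 2 := sum_fiMzero_le x D
  have h3 : ∑ d ∈ Icc 1 D, ∑ c' ∈ fiCRange N, (fiStripSlice x y d c' : ℝ) ≤ T * St :=
    (sum_sum_fiStripSlice_le hT D).trans (mul_le_mul_of_nonneg_left hstrip (Nat.cast_nonneg _))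
  have h4 : ∑ d ∈ Icc 1 D, |fiE x y d| ≤
      7 * (128 * Real.sqrt 2 * c * x ^ (11 / 8 + η + 5 / 2 * ε₃) / y + 32 * n.factorial * M) *
        Real.sqrt D := sum_abs_fiE_le hε₃ hε₃1 hc0 hc hx hη hxy hyx hn hηn hM0 hM hDx
  have h5 : ∑ d ∈ Icc 1 D, (∑ c' ∈ fiCRange N, (#(fiRoots (c'.natAbs ^ 2) d) : ℝ) *
      (fiStripSlice x y 1 c' + ‖fiPoissonErr x y c'‖)) / d ≤
        C * T * (1 + Real.log D) ^ 2 * (T * St + 2 * (Nat.sqrt (Nat.sqrt N)) * Pm) := by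
    have hw : ∀ c' ∈ fiCRange N, (0 : ℝ) ≤ fiStripSlice x y 1 c' + ‖fiPoissonErr x y c'‖ :=
      fun _ _ => by positivity
    refine (sum_div_sum_rho_mul_le hT hC hw D).trans ?_
    refine mul_le_mul_of_nonneg_left ?_ (by
      have := one_add_log_nonneg D; positivity)
    rw [sum_add_distrib]
    refine add_le_add ?_ ?_
    · have := sum_sum_fiStripSlice_le (x := x) (y := y) hT 1
      rw [Finset.Icc_self, sum_singleton] at this
      exact this.trans (mul_le_mul_of_nonneg_left hstrip (Nat.cast_nonneg _))
    · calc ∑ c' ∈ fiCRange N, ‖fiPoissonErr x y c'‖ ≤ ∑ _c ∈ fiCRange N, Pm :=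
            sum_le_sum fun c' _ => norm_fiPoissonErr_le hx hy0 hyx c' hn hM0 hM
        _ = 2 * (Nat.sqrt (Nat.sqrt N)) * Pm := sum_fiCRange_const N Pm
  linarith [h1, h2, h3, h4, h5]

/-! ### The choice `y = D^{1/4} x^{13/16}` -/

/-- The parameter facts in the analytic regime `x ≥ 16`, `1 ≤ D ≤ x^{3/4}/256`,
`y = D^{1/4} x^{13/16}`: `y ≤ x/4`, `x^{13/16} ≤ y`, `D ≤ x`, `y x^{-1/4} = D^{1/4} x^{9/16}`,
`√D ≤ D^{1/4} x^{9/16}`, `√x ≤ D^{1/4} x^{9/16}`. [cite: FriedlanderIwaniecAnnals1998, §3, "on choosing y = D^{1/4} x^{13/16}"] -/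
theorem analytic_params {x : ℝ} {D : ℕ} (hx : 16 ≤ x) (hD1 : 1 ≤ D)
    (hD : (D : ℝ) ≤ x ^ (3 / 4 : ℝ) / 256) :
    let y : ℝ := (D : ℝ) ^ (1 / 4 : ℝ) * x ^ (13 / 16 : ℝ)
    let X : ℝ := (D : ℝ) ^ (1 / 4 : ℝ) * x ^ (9 / 16 : ℝ)
    y ≤ x / 4 ∧ x ^ (13 / 16 : ℝ) ≤ y ∧ (D : ℝ) ≤ x ∧ y * x ^ (-(1 / 4 : ℝ)) = X ∧
      Real.sqrt D ≤ X ∧ Real.sqrt x ≤ X ∧ 1 ≤ X := by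
  intro y X
  have hx1 : 1 ≤ x := by linarith
  have hx0 : 0 < x := by linarith
  have hD0 : (0 : ℝ) < D := by exact_mod_cast hD1
  have hDr1 : (1 : ℝ) ≤ D := by exact_mod_cast hD1
  have hD4 : (1 : ℝ) ≤ (D : ℝ) ^ (1 / 4 : ℝ) := Real.one_le_rpow hDr1 (by norm_num)
  -- `D^{1/4} ≤ x^{3/16}/4`
  have hD14 : (D : ℝ) ^ (1 / 4 : ℝ) ≤ x ^ (3 / 16 : ℝ) / 4 := by
    have h256 : (256 : ℝ) = 4 ^ (4 : ℕ) := by norm_num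
    calc (D : ℝ) ^ (1 / 4 : ℝ) ≤ (x ^ (3 / 4 : ℝ) / 256) ^ (1 / 4 : ℝ) :=
          Real.rpow_le_rpow hD0.le hD (by norm_num)
      _ = x ^ (3 / 16 : ℝ) / 4 := by
          rw [Real.div_rpow (by positivity) (by norm_num), ← Real.rpow_mul hx0.le, h256,
            ← Real.rpow_natCast, ← Real.rpow_mul (by norm_num)]
          norm_num
  have h34x : x ^ (3 / 4 : ℝ) ≤ x := by
    calc x ^ (3 / 4 : ℝ) ≤ x ^ (1 : ℝ) := Real.rpow_le_rpow_of_exponent_le hx1 (by norm_num)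
      _ = x := Real.rpow_one x
  refine ⟨?_, ?_, ?_, ?_, ?_, ?_, ?_⟩
  · -- `y ≤ x/4`
    calc y ≤ x ^ (3 / 16 : ℝ) / 4 * x ^ (13 / 16 : ℝ) :=
          mul_le_mul_of_nonneg_right hD14 (by positivity)
      _ = x / 4 := by
          rw [div_mul_eq_mul_div, ← Real.rpow_add hx0]; norm_num
  · -- `x^{13/16} ≤ y`
    calc x ^ (13 / 16 : ℝ) = 1 * x ^ (13 / 16 : ℝ) := (one_mul _).symm
      _ ≤ y := mul_le_mul_of_nonneg_right hD4 (by positivity)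
  · -- `D ≤ x`
    exact hD.trans ((div_le_self (by positivity) (by norm_num)).trans h34x)
  · -- `y x^{-1/4} = X`
    show (D : ℝ) ^ (1 / 4 : ℝ) * x ^ (13 / 16 : ℝ) * x ^ (-(1 / 4 : ℝ)) =
      (D : ℝ) ^ (1 / 4 : ℝ) * x ^ (9 / 16 : ℝ)
    rw [mul_assoc, ← Real.rpow_add hx0]; norm_num
  · -- `√D = D^{1/4} D^{1/4} ≤ D^{1/4} x^{3/16}/4 ≤ X`
    calc Real.sqrt D = (D : ℝ) ^ (1 / 4 : ℝ) * (D : ℝ) ^ (1 / 4 : ℝ) := by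
          rw [Real.sqrt_eq_rpow, ← Real.rpow_add hD0]; norm_num
      _ ≤ (D : ℝ) ^ (1 / 4 : ℝ) * (x ^ (3 / 16 : ℝ) / 4) := mul_le_mul_of_nonneg_left hD14 (by positivity)
      _ ≤ (D : ℝ) ^ (1 / 4 : ℝ) * x ^ (9 / 16 : ℝ) := by
          refine mul_le_mul_of_nonneg_left ?_ (by positivity)
          calc x ^ (3 / 16 : ℝ) / 4 ≤ x ^ (3 / 16 : ℝ) := div_le_self (by positivity) (by norm_num)
            _ ≤ x ^ (9 / 16 : ℝ) := Real.rpow_le_rpow_of_exponent_le hx1 (by norm_num)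
  · -- `√x ≤ X`
    calc Real.sqrt x = 1 * x ^ (1 / 2 : ℝ) := by rw [Real.sqrt_eq_rpow, one_mul]
      _ ≤ (D : ℝ) ^ (1 / 4 : ℝ) * x ^ (9 / 16 : ℝ) :=
          mul_le_mul hD4 (Real.rpow_le_rpow_of_exponent_le hx1 (by norm_num)) (by positivity)
            (by positivity)
  · -- `1 ≤ X`
    calc (1 : ℝ) = 1 * 1 := (one_mul _).symm
      _ ≤ (D : ℝ) ^ (1 / 4 : ℝ) * x ^ (9 / 16 : ℝ) :=
          mul_le_mul hD4 (Real.one_le_rpow hx1 (by norm_num)) zero_le_one (by positivity)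

/-- **The trivial regime converted**: if `x < 16` or `x^{3/4} < 256 D`, then
`x^{3/4+ε₀/16} (1 + log D)² ≤ (16·(1+8)²·… ) D^{1/4} x^{9/16+ε}` — precisely
`≤ (1296 + 4 (1 + 16/ε₀)²) D^{1/4} x^{9/16+ε}` for `0 < ε₀ ≤ 1`, `ε₀ ≤ ε`, `D ≥ 1`.
[cite: FriedlanderIwaniecAnnals1998, §3, "Observe that (3.3) is trivial if y > x/2"] -/
theorem trivial_regime_le {x ε ε₀ : ℝ} (hx : 1 ≤ x) (hε₀ : 0 < ε₀) (hε₀1 : ε₀ ≤ 1) (hε₀ε : ε₀ ≤ ε)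
    {D : ℕ} (hD1 : 1 ≤ D) (hreg : x < 16 ∨ x ^ (3 / 4 : ℝ) < 256 * D) :
    x ^ (3 / 4 + ε₀ / 16) * (1 + Real.log D) ^ 2 ≤
      (1296 + 4 * (1 + 16 / ε₀) ^ 2) * (D : ℝ) ^ (1 / 4 : ℝ) * x ^ (9 / 16 + ε) := by
  have hx0 : 0 < x := by linarith
  have hDr1 : (1 : ℝ) ≤ D := by exact_mod_cast hD1
  have hD0 : (0 : ℝ) < D := by linarith
  have hε : 0 < ε := by linarith
  have hD4 : (1 : ℝ) ≤ (D : ℝ) ^ (1 / 4 : ℝ) := Real.one_le_rpow hDr1 (by norm_num)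
  have hx916 : (1 : ℝ) ≤ x ^ (9 / 16 + ε) := Real.one_le_rpow hx (by positivity)
  have hlog := one_add_log_nonneg D
  have hK2 : 0 ≤ 4 * (1 + 16 / ε₀) ^ 2 := by positivity
  rcases hreg with hx16 | hbig
  · -- `x < 16`: `x^{3/4+ε₀/16} ≤ x ≤ 16`, `(1 + log D)² ≤ 81 D^{1/4}`
    have h1 : x ^ (3 / 4 + ε₀ / 16) ≤ 16 := by
      calc x ^ (3 / 4 + ε₀ / 16) ≤ x ^ (1 : ℝ) := Real.rpow_le_rpow_of_exponent_le hx (by linarith)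
        _ ≤ 16 := by rw [Real.rpow_one]; exact hx16.le
    have h2 : (1 + Real.log D) ^ 2 ≤ 81 * (D : ℝ) ^ (1 / 4 : ℝ) := by
      have := one_add_log_sq_le_rpow hDr1 (by norm_num : (0 : ℝ) < 1 / 8)
      norm_num at this
      linarith
    calc x ^ (3 / 4 + ε₀ / 16) * (1 + Real.log D) ^ 2 ≤ 16 * (81 * (D : ℝ) ^ (1 / 4 : ℝ)) :=
          mul_le_mul h1 h2 (by positivity) (by norm_num)
      _ = 1296 * (D : ℝ) ^ (1 / 4 : ℝ) * 1 := by ring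
      _ ≤ 1296 * (D : ℝ) ^ (1 / 4 : ℝ) * x ^ (9 / 16 + ε) := by gcongr
      _ ≤ (1296 + 4 * (1 + 16 / ε₀) ^ 2) * (D : ℝ) ^ (1 / 4 : ℝ) * x ^ (9 / 16 + ε) := by
          gcongr; linarith
  · -- `x^{3/4} < 256 D`: `(1 + log D)² ≤ (1+16/ε₀)² D^{ε₀/8}` and
    -- `x^{3/16 + ε₀/16 - ε} D^{ε₀/8} ≤ 4 D^{1/4}`
    have h2 : (1 + Real.log D) ^ 2 ≤ (1 + 16 / ε₀) ^ 2 * (D : ℝ) ^ (ε₀ / 8) := by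
      have := one_add_log_sq_le_rpow hDr1 (by positivity : (0 : ℝ) < ε₀ / 16)
      rw [show 2 * (ε₀ / 16) = ε₀ / 8 by ring, show 1 / (ε₀ / 16) = 16 / ε₀ by field_simp] at this
      exact this
    -- the key exponent manipulation
    have h3 : x ^ (3 / 4 + ε₀ / 16) * (D : ℝ) ^ (ε₀ / 8) ≤ 4 * (D : ℝ) ^ (1 / 4 : ℝ) * x ^ (9 / 16 + ε) := by
      have hsplit : x ^ (3 / 4 + ε₀ / 16) = x ^ (9 / 16 + ε) * x ^ (3 / 16 + ε₀ / 16 - ε) := by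
        rw [← Real.rpow_add hx0]; ring_nf
      have hexp : x ^ (3 / 16 + ε₀ / 16 - ε) ≤ x ^ ((3 / 4 : ℝ) * (1 / 4 - ε₀ / 8)) :=
        Real.rpow_le_rpow_of_exponent_le hx (by nlinarith)
      have hpos8 : 0 ≤ 1 / 4 - ε₀ / 8 := by linarith
      have h4 : x ^ ((3 / 4 : ℝ) * (1 / 4 - ε₀ / 8)) ≤ 4 * (D : ℝ) ^ (1 / 4 - ε₀ / 8) := by
        rw [Real.rpow_mul hx0.le]
        calc (x ^ (3 / 4 : ℝ)) ^ (1 / 4 - ε₀ / 8) ≤ (256 * (D : ℝ)) ^ (1 / 4 - ε₀ / 8) :=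
              Real.rpow_le_rpow (by positivity) hbig.le hpos8
          _ = (256 : ℝ) ^ (1 / 4 - ε₀ / 8) * (D : ℝ) ^ (1 / 4 - ε₀ / 8) :=
              Real.mul_rpow (by norm_num) hD0.le
          _ ≤ 4 * (D : ℝ) ^ (1 / 4 - ε₀ / 8) := by
              gcongr
              calc (256 : ℝ) ^ (1 / 4 - ε₀ / 8) ≤ (256 : ℝ) ^ (1 / 4 : ℝ) :=
                    Real.rpow_le_rpow_of_exponent_le (by norm_num) (by linarith)
                _ = 4 := by
                    rw [show (256 : ℝ) = 4 ^ (4 : ℕ) by norm_num, ← Real.rpow_natCast,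
                      ← Real.rpow_mul (by norm_num)]
                    norm_num
      have h5 : (D : ℝ) ^ (1 / 4 - ε₀ / 8) * (D : ℝ) ^ (ε₀ / 8) = (D : ℝ) ^ (1 / 4 : ℝ) := by
        rw [← Real.rpow_add hD0]; ring_nf
      calc x ^ (3 / 4 + ε₀ / 16) * (D : ℝ) ^ (ε₀ / 8)
          = x ^ (9 / 16 + ε) * (x ^ (3 / 16 + ε₀ / 16 - ε) * (D : ℝ) ^ (ε₀ / 8)) := by
            rw [hsplit]; ring
        _ ≤ x ^ (9 / 16 + ε) * ((4 * (D : ℝ) ^ (1 / 4 - ε₀ / 8)) * (D : ℝ) ^ (ε₀ / 8)) := by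
            refine mul_le_mul_of_nonneg_left (mul_le_mul_of_nonneg_right (hexp.trans h4)
              (by positivity)) (by positivity)
        _ = 4 * (D : ℝ) ^ (1 / 4 : ℝ) * x ^ (9 / 16 + ε) := by rw [mul_assoc 4, h5]; ring
    calc x ^ (3 / 4 + ε₀ / 16) * (1 + Real.log D) ^ 2
        ≤ x ^ (3 / 4 + ε₀ / 16) * ((1 + 16 / ε₀) ^ 2 * (D : ℝ) ^ (ε₀ / 8)) :=
          mul_le_mul_of_nonneg_left h2 (by positivity)
      _ = (1 + 16 / ε₀) ^ 2 * (x ^ (3 / 4 + ε₀ / 16) * (D : ℝ) ^ (ε₀ / 8)) := by ring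
      _ ≤ (1 + 16 / ε₀) ^ 2 * (4 * (D : ℝ) ^ (1 / 4 : ℝ) * x ^ (9 / 16 + ε)) :=
          mul_le_mul_of_nonneg_left h3 (by positivity)
      _ = 4 * (1 + 16 / ε₀) ^ 2 * (D : ℝ) ^ (1 / 4 : ℝ) * x ^ (9 / 16 + ε) := by ring
      _ ≤ (1296 + 4 * (1 + 16 / ε₀) ^ 2) * (D : ℝ) ^ (1 / 4 : ℝ) * x ^ (9 / 16 + ε) := by
          gcongr; linarith

/-- The Poisson constants: `2C₁ · 4L(2π)^{-n} ≤ 16 n! M` when `√x/y ≤ x^{-η}`, `ηn ≥ 4`, `x ≥ 1`.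
[cite: FriedlanderIwaniecAnnals1998, §3 (3.12)] -/
theorem poisson_const_le {x y η : ℝ} (hx : 1 ≤ x) (hy0 : 0 < y) (hxy : x ^ (1 / 2 + η) ≤ y)
    {n : ℕ} (hηn : 4 ≤ η * n) {M : ℝ} (hM0 : 0 ≤ M) :
    2 * (Nat.sqrt (Nat.sqrt ⌊x⌋₊) : ℝ) * (4 * (2 * Real.sqrt x * (n.factorial * M *
      (2 * Real.sqrt x / y) ^ n)) * ((1 : ℝ) / (2 * π)) ^ n) ≤ 16 * n.factorial * M := by
  have hx0 : 0 < x := by linarith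
  have hC₁ := natSqrtSqrt_le_rpow hx0.le
  set a : ℝ := 2 * Real.sqrt x / y * (1 / (2 * π)) with ha
  have ha0 : 0 ≤ a := by positivity
  have ha1 : a ≤ x ^ (-η) := by
    have h1 : a ≤ Real.sqrt x / y := by
      rw [ha, show 2 * Real.sqrt x / y * (1 / (2 * π)) = Real.sqrt x / y * (1 / π) by field_simp]
      refine mul_le_of_le_one_right (by positivity) ?_
      rw [div_le_one Real.pi_pos]; linarith [Real.pi_gt_three]
    refine h1.trans ?_
    rw [div_le_iff₀ hy0, Real.sqrt_eq_rpow]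
    calc x ^ (1 / 2 : ℝ) = x ^ (-η) * x ^ (1 / 2 + η) := by rw [← Real.rpow_add hx0]; ring_nf
      _ ≤ x ^ (-η) * y := mul_le_mul_of_nonneg_left hxy (by positivity)
  have han : a ^ n ≤ x ^ (-(4 : ℝ)) := pow_le_rpow_neg_four hx ha0 ha1 hηn
  have hprod : x ^ (1 / 4 : ℝ) * Real.sqrt x * x ^ (-(4 : ℝ)) ≤ 1 := by
    rw [Real.sqrt_eq_rpow, ← Real.rpow_add hx0, ← Real.rpow_add hx0]
    exact Real.rpow_le_one_of_one_le_of_nonpos hx (by norm_num)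
  calc 2 * (Nat.sqrt (Nat.sqrt ⌊x⌋₊) : ℝ) * (4 * (2 * Real.sqrt x * (n.factorial * M *
        (2 * Real.sqrt x / y) ^ n)) * ((1 : ℝ) / (2 * π)) ^ n)
      = 16 * n.factorial * M * ((Nat.sqrt (Nat.sqrt ⌊x⌋₊) : ℝ) * Real.sqrt x * a ^ n) := by
        rw [ha, mul_pow]; ring
    _ ≤ 16 * n.factorial * M * (x ^ (1 / 4 : ℝ) * Real.sqrt x * x ^ (-(4 : ℝ))) := by gcongr
    _ ≤ 16 * n.factorial * M * 1 := by gcongr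
    _ = _ := mul_one _

/-- The main-term exponent: `x^{11/8+η+5ε₃/2}/y · √D = D^{1/4} x^{9/16} · x^{9ε₀/16}` for
`y = D^{1/4}x^{13/16}`, `η = ε₀/4`, `ε₃ = ε₀/8`. [cite: FriedlanderIwaniecAnnals1998, §3, "which yields (3.3)"] -/
theorem main_term_eq {x ε₀ : ℝ} (hx0 : 0 < x) {D : ℕ} (hD0 : (0 : ℝ) < D) :
    x ^ (11 / 8 + ε₀ / 4 + 5 / 2 * (ε₀ / 8)) / ((D : ℝ) ^ (1 / 4 : ℝ) * x ^ (13 / 16 : ℝ)) *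
      Real.sqrt D = (D : ℝ) ^ (1 / 4 : ℝ) * x ^ (9 / 16 : ℝ) * x ^ (9 / 16 * ε₀) := by
  have hD4 : 0 < (D : ℝ) ^ (1 / 4 : ℝ) := Real.rpow_pos_of_pos hD0 _
  have hx13 : 0 < x ^ (13 / 16 : ℝ) := Real.rpow_pos_of_pos hx0 _
  have hsqrt : Real.sqrt D = (D : ℝ) ^ (1 / 4 : ℝ) * (D : ℝ) ^ (1 / 4 : ℝ) := by
    rw [Real.sqrt_eq_rpow, ← Real.rpow_add hD0]; norm_num
  have hxsplit : x ^ (11 / 8 + ε₀ / 4 + 5 / 2 * (ε₀ / 8)) =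
      x ^ (13 / 16 : ℝ) * (x ^ (9 / 16 : ℝ) * x ^ (9 / 16 * ε₀)) := by
    rw [← Real.rpow_add hx0, ← Real.rpow_add hx0]; ring_nf
  rw [hsqrt, hxsplit]
  field_simp

/-- **The analytic regime, abstract bookkeeping**: with `X = D^{1/4}x^{9/16}`, `E = x^ε`,
`E16 = x^{ε₀/16}`, `E9 = x^{9ε₀/16}` and the bounds `√x, √D ≤ X`, `T ≤ C_T E16`,
`(1+log D)² ≤ A E16`, `strip ≤ 32X`, `Poisson ≤ 16F`, the summed estimate is `≤ K_A X E`. [folklore] -/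
theorem analytic_abstract {X E E16 E9 sx sD T L2 St Pm c F CT CH A Q : ℝ}
    (hX0 : 0 ≤ X) (hT0 : 0 ≤ T) (hL20 : 0 ≤ L2) (hSt0 : 0 ≤ St) (hPm0 : 0 ≤ Pm) (hc0 : 0 ≤ c)
    (hF0 : 0 ≤ F) (hCT0 : 0 ≤ CT) (hCH0 : 0 ≤ CH) (hA0 : 0 ≤ A)
    (hsx : sx ≤ X) (hsD : sD ≤ X) (hX1 : 1 ≤ X) (hT : T ≤ CT * E16) (hL2 : L2 ≤ A * E16)
    (hSt : St ≤ 32 * X) (hPm : Pm ≤ 16 * F) (hE16 : E16 ≤ E) (hE163 : E16 * E16 * E16 ≤ E)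
    (hE9 : E9 ≤ E) (hE1 : 1 ≤ E) (hE161 : 1 ≤ E16) (hQ : Q * sD = X * E9) :
    2 * sx * T + 2 * sx * L2 + T * St + 7 * (128 * Real.sqrt 2 * c * Q + 32 * F) * sD +
        CH * T * L2 * (T * St + Pm) ≤
      (2 * CT + 2 * A + 32 * CT + 896 * Real.sqrt 2 * c + 224 * F +
        CH * CT * A * (32 * CT + 16 * F)) * X * E := by
  have hXE : X ≤ X * E := le_mul_of_one_le_right hX0 hE1
  have hXE0 : 0 ≤ X * E := by positivity
  have t1 : 2 * sx * T ≤ 2 * CT * (X * E) := by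
    calc 2 * sx * T ≤ 2 * X * (CT * E16) := by gcongr
      _ = 2 * CT * (X * E16) := by ring
      _ ≤ 2 * CT * (X * E) := by gcongr
  have t2 : 2 * sx * L2 ≤ 2 * A * (X * E) := by
    calc 2 * sx * L2 ≤ 2 * X * (A * E16) := by gcongr
      _ = 2 * A * (X * E16) := by ring
      _ ≤ 2 * A * (X * E) := by gcongr
  have t3 : T * St ≤ 32 * CT * (X * E) := by
    calc T * St ≤ (CT * E16) * (32 * X) := mul_le_mul hT hSt hSt0 (by positivity)
      _ = 32 * CT * (X * E16) := by ring
      _ ≤ 32 * CT * (X * E) := by gcongr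
  have t4 : 7 * (128 * Real.sqrt 2 * c * Q + 32 * F) * sD ≤
      (896 * Real.sqrt 2 * c + 224 * F) * (X * E) := by
    have e : 7 * (128 * Real.sqrt 2 * c * Q + 32 * F) * sD =
        896 * Real.sqrt 2 * c * (Q * sD) + 224 * F * sD := by ring
    rw [e, hQ, add_mul]
    have h1 : 896 * Real.sqrt 2 * c * (X * E9) ≤ 896 * Real.sqrt 2 * c * (X * E) := by gcongr
    have h2 : 224 * F * sD ≤ 224 * F * (X * E) := by gcongr; exact hsD.trans hXE
    linarith
  have t5 : CH * T * L2 * (T * St + Pm) ≤ CH * CT * A * (32 * CT + 16 * F) * (X * E) := by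
    have hXE16 : 1 ≤ X * E16 := by nlinarith
    have hin : T * St + Pm ≤ (32 * CT + 16 * F) * (X * E16) := by
      have h1 : T * St ≤ (CT * E16) * (32 * X) := mul_le_mul hT hSt hSt0 (by positivity)
      have h2 : Pm ≤ 16 * F * (X * E16) := hPm.trans (le_mul_of_one_le_right (by positivity) hXE16)
      nlinarith
    have hin0 : 0 ≤ T * St + Pm := by positivity
    calc CH * T * L2 * (T * St + Pm)
        ≤ CH * (CT * E16) * (A * E16) * ((32 * CT + 16 * F) * (X * E16)) := by gcongr
      _ = CH * CT * A * (32 * CT + 16 * F) * (X * (E16 * E16 * E16)) := by ring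
      _ ≤ CH * CT * A * (32 * CT + 16 * F) * (X * E) := by gcongr
  calc _ ≤ 2 * CT * (X * E) + 2 * A * (X * E) + 32 * CT * (X * E) +
        (896 * Real.sqrt 2 * c + 224 * F) * (X * E) +
        CH * CT * A * (32 * CT + 16 * F) * (X * E) := by linarith [t1, t2, t3, t4, t5]
    _ = _ := by ring

/-- **The analytic regime converted**: the summed estimate with `y = D^{1/4} x^{13/16}` is
`≤ K_A · D^{1/4} x^{9/16+ε}`. [cite: FriedlanderIwaniecAnnals1998, §3, "which yields (3.3) on choosing y = D^{1/4} x^{13/16}"] -/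
theorem analytic_regime_le {x ε ε₀ c M CT : ℝ} {CH T n : ℕ} {D : ℕ} (hx : 16 ≤ x) (hD1 : 1 ≤ D)
    (hD : (D : ℝ) ≤ x ^ (3 / 4 : ℝ) / 256) (hε₀ : 0 < ε₀) (hε₀1 : ε₀ ≤ 1) (hε₀ε : ε₀ ≤ ε)
    (hc0 : 0 ≤ c) (hM0 : 0 ≤ M) (hCT0 : 0 ≤ CT) (hTle : (T : ℝ) ≤ CT * x ^ (ε₀ / 16))
    (hηn : 4 ≤ ε₀ / 4 * n) :
    2 * Real.sqrt x * T + 2 * Real.sqrt x * (1 + Real.log D) ^ 2 +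
        T * (4 * ((D : ℝ) ^ (1 / 4 : ℝ) * x ^ (13 / 16 : ℝ)) * x ^ (-(1 / 4 : ℝ)) + 28 * Real.sqrt x) +
        7 * (128 * Real.sqrt 2 * c * x ^ (11 / 8 + ε₀ / 4 + 5 / 2 * (ε₀ / 8)) /
          ((D : ℝ) ^ (1 / 4 : ℝ) * x ^ (13 / 16 : ℝ)) + 32 * n.factorial * M) * Real.sqrt D +
        CH * T * (1 + Real.log D) ^ 2 *
          (T * (4 * ((D : ℝ) ^ (1 / 4 : ℝ) * x ^ (13 / 16 : ℝ)) * x ^ (-(1 / 4 : ℝ)) + 28 * Real.sqrt x) +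
          2 * (Nat.sqrt (Nat.sqrt ⌊x⌋₊)) * (4 * (2 * Real.sqrt x * (n.factorial * M *
            (2 * Real.sqrt x / ((D : ℝ) ^ (1 / 4 : ℝ) * x ^ (13 / 16 : ℝ))) ^ n)) *
            ((1 : ℝ) / (2 * π)) ^ n)) ≤
      (2 * CT + 2 * (1 + 32 / ε₀) ^ 2 + 32 * CT + 896 * Real.sqrt 2 * c + 224 * (n.factorial * M) +
        CH * CT * (1 + 32 / ε₀) ^ 2 * (32 * CT + 16 * (n.factorial * M))) *
        ((D : ℝ) ^ (1 / 4 : ℝ) * x ^ (9 / 16 : ℝ)) * x ^ ε := by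
  obtain ⟨hy4, hy13, hDx, hyX, hsD, hsx, hX1⟩ := analytic_params hx hD1 hD
  set y : ℝ := (D : ℝ) ^ (1 / 4 : ℝ) * x ^ (13 / 16 : ℝ) with hy
  set X : ℝ := (D : ℝ) ^ (1 / 4 : ℝ) * x ^ (9 / 16 : ℝ) with hX
  have hx1 : 1 ≤ x := by linarith
  have hx0 : 0 < x := by linarith
  have hD0 : (0 : ℝ) < D := by exact_mod_cast hD1
  have hy0 : 0 < y := by positivity
  have hxy : x ^ (1 / 2 + ε₀ / 4) ≤ y :=
    le_trans (Real.rpow_le_rpow_of_exponent_le hx1 (by linarith)) hy13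
  -- the abstract inputs
  have hSt : 4 * y * x ^ (-(1 / 4 : ℝ)) + 28 * Real.sqrt x ≤ 32 * X := by
    rw [mul_assoc, hyX]; linarith
  have hL : (1 + Real.log D) ^ 2 ≤ (1 + 32 / ε₀) ^ 2 * x ^ (ε₀ / 16) := by
    have h1 : (1 + Real.log D) ^ 2 ≤ (1 + Real.log x) ^ 2 := by
      have := one_add_log_nonneg D
      have : Real.log D ≤ Real.log x := Real.log_le_log hD0 hDx
      nlinarith
    refine h1.trans ?_
    have := one_add_log_sq_le_rpow hx1 (by positivity : (0 : ℝ) < ε₀ / 32)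
    rw [show 2 * (ε₀ / 32) = ε₀ / 16 by ring, show 1 / (ε₀ / 32) = 32 / ε₀ by field_simp] at this
    exact this
  have hP := poisson_const_le hx1 hy0 hxy hηn hM0 (n := n)
  have hmain : x ^ (11 / 8 + ε₀ / 4 + 5 / 2 * (ε₀ / 8)) / y * Real.sqrt D = X * x ^ (9 / 16 * ε₀) :=
    main_term_eq hx0 hD0
  have hE16 : x ^ (ε₀ / 16) ≤ x ^ ε := Real.rpow_le_rpow_of_exponent_le hx1 (by linarith)
  have hE163 : x ^ (ε₀ / 16) * x ^ (ε₀ / 16) * x ^ (ε₀ / 16) ≤ x ^ ε := by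
    rw [← Real.rpow_add hx0, ← Real.rpow_add hx0]
    exact Real.rpow_le_rpow_of_exponent_le hx1 (by linarith)
  have hE9 : x ^ (9 / 16 * ε₀) ≤ x ^ ε := Real.rpow_le_rpow_of_exponent_le hx1 (by linarith)
  have hE1 : (1 : ℝ) ≤ x ^ ε := Real.one_le_rpow hx1 (by linarith)
  have hE161 : (1 : ℝ) ≤ x ^ (ε₀ / 16) := Real.one_le_rpow hx1 (by positivity)
  have key := analytic_abstract (X := X) (E := x ^ ε) (E16 := x ^ (ε₀ / 16)) (E9 := x ^ (9 / 16 * ε₀))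
    (sx := Real.sqrt x) (sD := Real.sqrt D) (T := T) (L2 := (1 + Real.log D) ^ 2)
    (St := 4 * y * x ^ (-(1 / 4 : ℝ)) + 28 * Real.sqrt x)
    (Pm := 2 * (Nat.sqrt (Nat.sqrt ⌊x⌋₊) : ℝ) * (4 * (2 * Real.sqrt x * (n.factorial * M *
      (2 * Real.sqrt x / y) ^ n)) * ((1 : ℝ) / (2 * π)) ^ n))
    (c := c) (F := n.factorial * M) (CT := CT) (CH := CH) (A := (1 + 32 / ε₀) ^ 2)
    (Q := x ^ (11 / 8 + ε₀ / 4 + 5 / 2 * (ε₀ / 8)) / y)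
    (by positivity) (by positivity) (by positivity) (by positivity) (by positivity) hc0
    (by positivity) hCT0 (by positivity) (by positivity) hsx hsD hX1 hTle hL hSt
    (hP.trans (le_of_eq (by ring))) hE16 hE163 hE9 hE1 hE161 hmain
  refine le_trans (le_of_eq ?_) key
  ring

end Literature.NumberTheory.Sieve.FriedlanderIwaniecPrimes

namespace Literature.NumberTheory.Sieve

open FriedlanderIwaniecPrimes

/-- **Friedlander–Iwaniec Lemma 3.1, PROVED**: for every `ε > 0` there is `K` with
`∑_{d ≤ D} |A_d(x) - M_d(x)| ≤ K D^{1/4} x^{9/16+ε}` for all `x ≥ 1`, `D ≥ 1`.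
[cite: FriedlanderIwaniecAnnals1998, §3 Lemma 3.1 (3.3)] -/
theorem FriedlanderIwaniec1998_lemma31_holds : FriedlanderIwaniec1998_lemma31 := by
  intro ε hε
  -- parameters
  set ε₀ : ℝ := min ε 1 with hε₀def
  have hε₀ : 0 < ε₀ := lt_min hε one_pos
  have hε₀1 : ε₀ ≤ 1 := min_le_right _ _
  have hε₀ε : ε₀ ≤ ε := min_le_left _ _
  set n : ℕ := ⌈16 / ε₀⌉₊ + 2 with hn
  have hn2 : 2 ≤ n := by omega
  have hηn : 4 ≤ ε₀ / 4 * n := by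
    have h1 : 16 / ε₀ ≤ n := by
      calc 16 / ε₀ ≤ (⌈16 / ε₀⌉₊ : ℝ) := Nat.le_ceil _
        _ ≤ n := by rw [hn]; push_cast; linarith
    calc (4 : ℝ) = ε₀ / 4 * (16 / ε₀) := by field_simp; ring
      _ ≤ ε₀ / 4 * n := mul_le_mul_of_nonneg_left h1 (by positivity)
  obtain ⟨c, hc0, hc⟩ := fi_lemma33 (ε := ε₀ / 8) (by positivity)
  obtain ⟨CH, hCH1, hCH⟩ := exists_fiRho_le_mul_card_divisors
  obtain ⟨CT, hCT1, hCT⟩ := exists_card_divisors_le_mul_rpow (ε := ε₀ / 16) (by positivity)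
  obtain ⟨M, hM1, hM⟩ := exists_bound_iteratedFDeriv_smoothTransition n
  have hM0 : 0 ≤ M := zero_le_one.trans hM1
  have hCT0 : 0 ≤ CT := zero_le_one.trans hCT1
  set KA : ℝ := 2 * CT + 2 * (1 + 32 / ε₀) ^ 2 + 32 * CT + 896 * Real.sqrt 2 * c +
    224 * (n.factorial * M) + CH * CT * (1 + 32 / ε₀) ^ 2 * (32 * CT + 16 * (n.factorial * M))
    with hKA
  set KB : ℝ := 40 * CH * CT * (1296 + 4 * (1 + 16 / ε₀) ^ 2) with hKB
  have hKA0 : 0 ≤ KA := by positivity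
  have hKB0 : 0 ≤ KB := by positivity
  refine ⟨KA + KB, fun x hx D hD => ?_⟩
  have hx0 : 0 < x := by linarith
  have hD0 : 0 < D := by linarith
  set Dn : ℕ := ⌊D⌋₊ with hDn
  have hDn1 : 1 ≤ Dn := Nat.le_floor (by simpa using hD)
  have hDnD : (Dn : ℝ) ≤ D := Nat.floor_le hD0.le
  have hDn4 : (Dn : ℝ) ^ (1 / 4 : ℝ) ≤ D ^ (1 / 4 : ℝ) :=
    Real.rpow_le_rpow (Nat.cast_nonneg _) hDnD (by norm_num)
  have hx916 : 0 ≤ x ^ (9 / 16 + ε) := by positivity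
  -- the divisor bound on `[1, ⌊x⌋]`
  set T : ℕ := ⌊CT * x ^ (ε₀ / 16)⌋₊ with hTdef
  have hT : ∀ m : ℕ, m ≠ 0 → m ≤ ⌊x⌋₊ → #m.divisors ≤ T := by
    intro m hm0 hmx
    have hmx' : (m : ℝ) ≤ x := le_trans (by exact_mod_cast hmx) (Nat.floor_le hx0.le)
    have h1 : (#m.divisors : ℝ) ≤ CT * x ^ (ε₀ / 16) :=
      (hCT m hm0).trans (mul_le_mul_of_nonneg_left
        (Real.rpow_le_rpow (Nat.cast_nonneg _) hmx' (by positivity)) hCT0)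
    exact Nat.le_floor h1
  have hTle : (T : ℝ) ≤ CT * x ^ (ε₀ / 16) := Nat.floor_le (by positivity)
  have hT1 : 1 ≤ T := by
    have := hT 1 one_ne_zero (Nat.le_floor (by simpa using hx))
    simpa using this
  by_cases hreg : 16 ≤ x ∧ (Dn : ℝ) ≤ x ^ (3 / 4 : ℝ) / 256
  · -- the analytic regime, `y = Dn^{1/4} x^{13/16}`
    obtain ⟨hx16, hDnx⟩ := hreg
    obtain ⟨hy4, hy13, hDnx', -, -, -, -⟩ := analytic_params hx16 hDn1 hDnx
    set y : ℝ := (Dn : ℝ) ^ (1 / 4 : ℝ) * x ^ (13 / 16 : ℝ) with hy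
    have hxy : x ^ (1 / 2 + ε₀ / 4) ≤ y :=
      le_trans (Real.rpow_le_rpow_of_exponent_le hx (by linarith)) hy13
    have hy2 : 2 * y ≤ x := by linarith
    have hxy1 : 1 ≤ x - y := by linarith
    have h1 := sum_abs_sub_le_analytic (ε₃ := ε₀ / 8) (by positivity) (by linarith) hc0 hc hx
      (η := ε₀ / 4) (by positivity) hxy hy2 hxy1 hn2 hηn hM0 hM hT hCH hDnx'
    have h2 := analytic_regime_le (CH := CH) hx16 hDn1 hDnx hε₀ hε₀1 hε₀ε hc0.le hM0 hCT0 hTle hηn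
    rw [← hy] at h2
    calc ∑ d ∈ Icc 1 Dn, |fiSieveSeq.congrSum d x - fiMainTerm d x|
        ≤ _ := h1
      _ ≤ KA * ((Dn : ℝ) ^ (1 / 4 : ℝ) * x ^ (9 / 16 : ℝ)) * x ^ ε := h2
      _ = KA * (Dn : ℝ) ^ (1 / 4 : ℝ) * x ^ (9 / 16 + ε) := by
          rw [Real.rpow_add hx0]; ring
      _ ≤ (KA + KB) * D ^ (1 / 4 : ℝ) * x ^ (9 / 16 + ε) := by
          gcongr
          linarith
  · -- the trivial regime
    have hreg' : x < 16 ∨ x ^ (3 / 4 : ℝ) < 256 * Dn := by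
      rcases not_and_or.mp hreg with h | h
      · exact Or.inl (not_le.mp h)
      · right; have := not_le.mp h; linarith
    have h1 := sum_abs_sub_le_trivial hx hT hT1 hCH1 hCH Dn
    have h2 := trivial_regime_le hx hε₀ hε₀1 hε₀ε hDn1 hreg'
    have hlog := FriedlanderIwaniecPrimes.one_add_log_nonneg Dn
    calc ∑ d ∈ Icc 1 Dn, |fiSieveSeq.congrSum d x - fiMainTerm d x|
        ≤ 40 * CH * T * x ^ (3 / 4 : ℝ) * (1 + Real.log Dn) ^ 2 := h1
      _ ≤ 40 * CH * (CT * x ^ (ε₀ / 16)) * x ^ (3 / 4 : ℝ) * (1 + Real.log Dn) ^ 2 := by gcongr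
      _ = 40 * CH * CT * (x ^ (3 / 4 + ε₀ / 16) * (1 + Real.log Dn) ^ 2) := by
          rw [Real.rpow_add hx0]; ring
      _ ≤ 40 * CH * CT * ((1296 + 4 * (1 + 16 / ε₀) ^ 2) * (Dn : ℝ) ^ (1 / 4 : ℝ) * x ^ (9 / 16 + ε)) :=
          mul_le_mul_of_nonneg_left h2 (by positivity)
      _ = KB * (Dn : ℝ) ^ (1 / 4 : ℝ) * x ^ (9 / 16 + ε) := by rw [hKB]; ring
      _ ≤ (KA + KB) * D ^ (1 / 4 : ℝ) * x ^ (9 / 16 + ε) := by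
          gcongr
          linarith

/-- **Proposition 3.5 PROVED** (from Lemma 3.1 via `FriedlanderIwaniec1998_prop35_of_lemma31`).
[cite: FriedlanderIwaniecAnnals1998, §3 Proposition 3.5 (3.18)] -/
theorem FriedlanderIwaniec1998_prop35_holds : FriedlanderIwaniec1998_prop35 :=
  FriedlanderIwaniec1998_prop35_of_lemma31 FriedlanderIwaniec1998_lemma31_holds

/-- **parity.S17 from the two remaining inputs**: the asymptotic sieve for primes in the rough
form (companion paper, Theorem 1 with (B*)) and the bilinear estimate Proposition 4.1 (§§4–26).
[cite: FriedlanderIwaniecAnnals1998, Theorem 1] -/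
theorem friedlanderIwaniecSum_isEquivalent_of_rough_prop41
    (hR : fi_asymptotic_sieve_primes_rough_loglog) (h41 : FriedlanderIwaniec1998_prop41) :
    friedlanderIwaniecSum_isEquivalent :=
  friedlanderIwaniecSum_isEquivalent_of_rough_lemma31_inputs hR FriedlanderIwaniec1998_lemma31_holds h41

/-- **Infinitely many primes `a² + b⁴` from the two remaining inputs.**
[cite: FriedlanderIwaniecAnnals1998, Theorem 1] -/
theorem setOf_prime_sq_add_pow_four_infinite_of_rough_prop41
    (hR : fi_asymptotic_sieve_primes_rough_loglog) (h41 : FriedlanderIwaniec1998_prop41) :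
    setOf_prime_sq_add_pow_four_infinite :=
  setOf_prime_sq_add_pow_four_infinite_of_rough_lemma31_inputs hR
    FriedlanderIwaniec1998_lemma31_holds h41

end Literature.NumberTheory.Sieve
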